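import Literature.NumberTheory.Rogawski1990.RankOneUnstableDeltaValueRamifiedTame       -- ★ p843598 B-p10 (g26) R-4b: `hilbertSymbol_neg_one_eq_one_iff_of_odd`, `odd_log_valued_of_eq_exp_neg_one`
import Literature.NumberTheory.Rogawski1990.RankOneUnstableRamifiedSignCoherence       -- ★ p843757 A-p19 (g23) (R5b-σ): `ite_isSquare_neg_one_pow_mul`
import Literature.NumberTheory.Automorphic.RamifiedPlaceResidueFieldBridge              -- ★ p843745 A-p19 (g23): `isSquare_residue_toPlace_iff_of_ramified`
import Literature.NumberTheory.Automorphic.RamifiedPlaceIntegerInvolution              -- ★ p843642 A-p19 (g23) R-0c: `isUnit_integer_of_v_eq_one`, `isUnit_two_integer_of_v_two_eq_one`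
import HarnessLib

/-!
# THE SIGN SEAM of the R-5b END (road «R1LL-tree», tame-ramified branch): window BITS ↦ the signed-pair clause of ★ `rankOneUnstable_core_of_signedPairs`, and `(−1, π)_v` as the
# residue sign `[res_w (−1)]` (Labesse–Langlands 1979 §2 p. 9; Rogawski 1990 §4.9 (4.9.2); Serre, *Local Fields* XIV §3)

Topic `NumberTheory/Rogawski1990`; namespace `Literature.NumberTheory.Rogawski1990`.  THEOREMS ONLY (no definition, no instance, no notation, no named fact, no `sorry`).
Cell `pub/hodgecm-mathlib` (D-0151), crux H413 = `stmt-HodgeConjecture-24833`, line «N6nsGerm» stub `stub_N6nsR1ram` (ED. 1.11), residue ★ `RankOneUnstableTransferNonsplitCMERamified`.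
HONEST LABEL: HC_CM is proved only modulo the printed citations (the 2 remaining named inputs hLiu418, h413) until rung 0 closes; this file is unconditional local algebra.
Architect A-p16 (g28) (own bytes; END assembler F0P3a-p03 (g12), heir A-p16).

WHY.  Three ★ currencies meet in the END's `obtain` chain and this file is the glue so that the seam is `exact`:
* ★ F0P3a-p03 (g12) `rankOneUnstable_core_of_signedPairs` (p843850) wants, per piece `k` and window index `i`, **`(−1)^(b i) = σ k * εD t * s₀ ^ ((N t + i + 1) ∕ 2)`** with an
  ABSTRACT `s₀ : ℂ` and an abstract D-side sign `εD t`;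
* ★ F0P3-p01 (g14) `depthExpansion_pair_ramified_selfDual` (p843849; EDGE piece, and its VERTEX twin) delivers BITS: `b i ≤ 1` and `b i = 0 ↔ IsSquare (residue S)` for every
  `S ∈ 𝒪[L_w]` with `↑S = (−1) ^ ((N + i) ∕ 2 + 1) * τ₁ * ((τ₀ − τ₁) * (ϖ ^ N)⁻¹) * h 0` (vertex: exponent `(N + i + 1) ∕ 2 + 1` and token `−h 0`), after ★ B-p12 FILE 5∕7;
* ★ A-p19 (g23) R-4c⁺ ED. 2 `exists_rankOneDelta_mul_sign_eq_of_ramified_tame` pins `εD` by `↑S = τ₁ * ((τ₀ − τ₁) * (ϖE ^ N)⁻¹) * θ₀ → εD t = [res S]` and writes the sign of `−1` as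
  the Hilbert symbol `((hilbertSymbol L⁺_v (−1) π : ℤ) : ℂ)`.
Here `[a] := if IsSquare a then 1 else −1 ∈ ℂ`.

* §1 (any valuation ring `𝒪[F]` with finite residue field): `neg_one_pow_eq_ite_of_bit` (`(−1)^b = [res S]`), **`neg_one_pow_bit_eq_sign_pow_mul`** (`(−1)^b = [res (−1)]^n · εD`
  from the two specs), `ite_isSquare_residue_neg_one_sq` (`[res (−1)]² = 1`).
* §2 (any completion `K_w`; the PAIR's and R-4c⁺'s LITERAL associations `(−1)^n * c * U * θ` ∕ `c * U * θ`, units by `Valued.v · = 1`, abstract `s₀` with `hs₀ : s₀ = [res_w (−1)]`):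
  **`neg_one_pow_bit_eq_edge`** (`(−1)^b = s₀ * εD * s₀ ^ ((N + i + 1) ∕ 2)` when `(N + i) % 2 = 0`) and **`neg_one_pow_bit_eq_vertex`** (`(−1)^b = 1 * εD * s₀ ^ ((N + i + 1) ∕ 2)`,
  token `−θ`) — ★ p843850's `hpair` sign clause VERBATIM with `σ k = s₀` (edge) ∕ `σ k = 1` (vertex).
* §3 (CM, tamely ramified non-split `w ∣ v`): **`intCast_hilbertSymbol_neg_one_eq_ite_of_ramified`**: `((hilbertSymbol L⁺_v (−1) π : ℤ) : ℂ) = [res_w (−1)]` for `π` a uniformiser of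
  `L⁺_v` — the `hs₀` the END passes when it instantiates `s₀` with A-p19's cast (★ `hilbertSymbol_neg_one_eq_one_iff_of_odd` ∘ ★ `isSquare_residue_toPlace_iff_of_ramified`).

## References
* [LabesseLanglands1979] J.-P. Labesse, R. P. Langlands, *L-indistinguishability for SL(2)*, Canad. J. Math. 31 (1979): §2 p. 9 (the signs `(−1)^m`, `δ_m`).
* [Rogawski1990] J. D. Rogawski, *Automorphic Representations of Unitary Groups in Three Variables*, Ann. of Math. Stud. 123 (1990): §4.9 Lemma 4.9.3 (4.9.2) p. 56.
* [Serre1979] J.-P. Serre, *Local Fields*, GTM 67 (1979): Ch. XIV §3 (tame symbol `(−1, π) = (−1)^{(q−1)∕2}`); Ch. V §3.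
* [IrelandRosen1990] K. Ireland, M. Rosen, *A Classical Introduction to Modern Number Theory* (1990): Ch. 5 §1.
-/

set_option autoImplicit false

noncomputable section

open NumberField IsDedekindDomain IsLocalRing
open scoped ValuativeRel

namespace Literature.NumberTheory.Rogawski1990

open Literature.NumberTheory.Automorphic Literature.NumberTheory.Automorphic.UnitaryGroup Literature.NumberTheory.QuadraticForms

/-! ## §1 Bits ↦ signs on a valuation ring -/

section Bit

variable {F : Type*} [Field F] [ValuativeRel F]

open scoped Classical in
/-- **A window bit IS a residue sign**: `b ≤ 1` and `b = 0 ↔ s̄ ∈ 𝓀²` give `(−1)^b = [s̄]`. [cite: LabesseLanglands1979, §2 p. 9] -/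
theorem neg_one_pow_eq_ite_of_bit {b : ℕ} (hb : b ≤ 1) {S : 𝒪[F]} (h : b = 0 ↔ IsSquare (residue 𝒪[F] S)) :
    (-1 : ℂ) ^ b = if IsSquare (residue 𝒪[F] S) then 1 else -1 := by
  interval_cases b
  · rw [pow_zero, if_pos (h.1 rfl)]
  · rw [pow_one, if_neg (fun hs => absurd (h.2 hs) one_ne_zero)]

open scoped Classical in
/-- **THE ADAPTER**: a bit spec'd on the datum `(−1)^n · x` and a D-side sign spec'd on `x` (a unit of `𝒪`) satisfy `(−1)^b = [res (−1)]^n · εD` (`[·]` is multiplicative on `𝓀ˣ`).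
[cite: LabesseLanglands1979, §2 p. 9] [cite: IrelandRosen1990, Ch. 5 §1] -/
theorem neg_one_pow_bit_eq_sign_pow_mul [Finite (ResidueField 𝒪[F])] {b n : ℕ} (hb : b ≤ 1) {x : F} (S₀ : 𝒪[F]) (hS₀ : IsUnit S₀) (hS₀x : (S₀ : F) = x)
    {εD : ℂ} (hεD : ∀ S : 𝒪[F], (S : F) = x → εD = if IsSquare (residue 𝒪[F] S) then 1 else -1)
    (hbit : ∀ S : 𝒪[F], (S : F) = (-1) ^ n * x → (b = 0 ↔ IsSquare (residue 𝒪[F] S))) :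
    (-1 : ℂ) ^ b = (if IsSquare (residue 𝒪[F] (-1)) then (1 : ℂ) else -1) ^ n * εD := by
  classical
  letI : Fintype (ResidueField 𝒪[F]) := Fintype.ofFinite _
  have hS : (((-1) ^ n * S₀ : 𝒪[F]) : F) = (-1) ^ n * x := by
    rw [Subring.coe_mul, Subring.coe_pow, Subring.coe_neg, Subring.coe_one, hS₀x]
  rw [neg_one_pow_eq_ite_of_bit hb (hbit _ hS), hεD S₀ hS₀x]
  simp only [map_mul, map_pow, map_neg, map_one]
  convert ite_isSquare_neg_one_pow_mul ((residue_ne_zero_iff_isUnit _).2 hS₀) n using 3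

open scoped Classical in
/-- `[res (−1)]² = 1`. [cite: IrelandRosen1990, Ch. 5 §1] -/
theorem ite_isSquare_residue_neg_one_sq : (if IsSquare (residue 𝒪[F] (-1)) then (1 : ℂ) else -1) ^ 2 = 1 := by
  split_ifs <;> norm_num

end Bit

/-! ## §2 The two piece types in ★ `rankOneUnstable_core_of_signedPairs`'s clause shape, at a completion `K_w` -/

section Pieces

variable {K : Type} [Field K] [NumberField K] (w : HeightOneSpectrum (𝓞 K))

/-- The D-side datum `c · U · θ` of three `| · |_w = 1` elements is a unit of `𝒪[K_w]` (as the subtype element). [cite: Serre1979, Ch. V §3] -/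
theorem isUnit_integer_mul_mul_of_v_eq_one {c U θ : w.adicCompletion K} (hc : Valued.v c = 1) (hU : Valued.v U = 1) (hθ : Valued.v θ = 1) :
    IsUnit (⟨c * U * θ, (v_le_one_iff_mem_integer _).1 (by rw [map_mul, map_mul, hc, hU, hθ, one_mul, one_mul])⟩ : 𝒪[w.adicCompletion K]) :=
  isUnit_integer_of_v_eq_one w (by rw [map_mul, map_mul, hc, hU, hθ, one_mul, one_mul])

open scoped Classical in
/-- **EDGE PIECE (`σ k = s₀`).**  Window index `i` with `N + i` even (odd `i` on the letter's odd-depth torus), PAIR bit spec on `(−1)^((N+i)∕2+1) · c · U · θ` (★ p843849's token: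
`c = τ₁(t)_w`, `U = (τ₀ t − τ₁ t)_w · (ϖ^{N t})⁻¹`, `θ = h 0`), D-sign spec on `c · U · θ` (★ R-4c⁺ ED. 2), `s₀ = [res_w (−1)]`:  `(−1)^b = s₀ · εD · s₀^{(N+i+1)∕2}` — the `hpair`
sign clause of ★ `rankOneUnstable_core_of_signedPairs` for an edge piece, VERBATIM. [cite: LabesseLanglands1979, §2 p. 9] [cite: Rogawski1990, §4.9 Lemma 4.9.3 (4.9.2) p. 56] -/
theorem neg_one_pow_bit_eq_edge {c U θ : w.adicCompletion K} (hc : Valued.v c = 1) (hU : Valued.v U = 1) (hθ : Valued.v θ = 1)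
    {s₀ : ℂ} (hs₀ : s₀ = if IsSquare (residue 𝒪[w.adicCompletion K] (-1)) then 1 else -1)
    {εD : ℂ} (hεD : ∀ S : 𝒪[w.adicCompletion K], (S : w.adicCompletion K) = c * U * θ → εD = if IsSquare (residue 𝒪[w.adicCompletion K] S) then 1 else -1)
    {N i b : ℕ} (hNi : (N + i) % 2 = 0) (hb : b ≤ 1)
    (hbit : ∀ S : 𝒪[w.adicCompletion K], (S : w.adicCompletion K) = (-1) ^ ((N + i) / 2 + 1) * c * U * θ → (b = 0 ↔ IsSquare (residue 𝒪[w.adicCompletion K] S))) :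
    (-1 : ℂ) ^ b = s₀ * εD * s₀ ^ ((N + i + 1) / 2) := by
  have h := neg_one_pow_bit_eq_sign_pow_mul (x := c * U * θ) (n := (N + i) / 2 + 1) hb _ (isUnit_integer_mul_mul_of_v_eq_one w hc hU hθ) rfl hεD
    (fun S hS => hbit S (by rw [hS]; ring))
  have hdiv : (N + i + 1) / 2 = (N + i) / 2 := by omega
  rw [h, ← hs₀, hdiv, pow_succ]
  ring

open scoped Classical in
/-- **VERTEX PIECE (`σ k = 1`).**  Window index `i` with the vertex exponent `(N+i+1)∕2+1` and the vertex token `−θ` (★ B-p12 FILE 7-modular: `ϖ·θ♯ = −h 0`), D-sign spec on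
`c · U · θ`, `s₀ = [res_w (−1)]`:  `(−1)^b = 1 · εD · s₀^{(N+i+1)∕2}` — the `hpair` sign clause of ★ `rankOneUnstable_core_of_signedPairs` for a vertex piece, VERBATIM (`s₀² = 1`).
[cite: LabesseLanglands1979, §2 p. 9] [cite: Rogawski1990, §4.9 Lemma 4.9.3 (4.9.2) p. 56] -/
theorem neg_one_pow_bit_eq_vertex {c U θ : w.adicCompletion K} (hc : Valued.v c = 1) (hU : Valued.v U = 1) (hθ : Valued.v θ = 1)
    {s₀ : ℂ} (hs₀ : s₀ = if IsSquare (residue 𝒪[w.adicCompletion K] (-1)) then 1 else -1)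
    {εD : ℂ} (hεD : ∀ S : 𝒪[w.adicCompletion K], (S : w.adicCompletion K) = c * U * θ → εD = if IsSquare (residue 𝒪[w.adicCompletion K] S) then 1 else -1)
    {N i b : ℕ} (hb : b ≤ 1)
    (hbit : ∀ S : 𝒪[w.adicCompletion K], (S : w.adicCompletion K) = (-1) ^ ((N + i + 1) / 2 + 1) * c * U * -θ → (b = 0 ↔ IsSquare (residue 𝒪[w.adicCompletion K] S))) :
    (-1 : ℂ) ^ b = 1 * εD * s₀ ^ ((N + i + 1) / 2) := by
  have h := neg_one_pow_bit_eq_sign_pow_mul (x := c * U * θ) (n := (N + i + 1) / 2 + 1 + 1) hb _ (isUnit_integer_mul_mul_of_v_eq_one w hc hU hθ) rfl hεD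
    (fun S hS => hbit S (by rw [hS]; ring))
  have hsq : s₀ ^ 2 = 1 := by rw [hs₀]; exact ite_isSquare_residue_neg_one_sq
  rw [h, ← hs₀, show (N + i + 1) / 2 + 1 + 1 = (N + i + 1) / 2 + 2 from rfl, pow_add, hsq]
  ring

end Pieces

/-! ## §3 `(−1, π)_v` is the residue sign `[res_w (−1)]` at a tamely ramified non-split CM place -/

section CM

variable (L : Type) [Field L] [NumberField L] [IsCMField L] (v : HeightOneSpectrum (𝓞 ↥(maximalRealSubfield L)))
  (w : PlacesOver L v) (hw : IsCMField.complexConj L • w.1 = w.1)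

/-- Squares are injective on `ℤₘ₀` (local copy of ★ R-4c⁺'s private helper). [folklore] -/
private theorem eq_of_sq_eq_sq_seam {a b : WithZero (Multiplicative ℤ)} (h : a ^ 2 = b ^ 2) : a = b := by
  rcases eq_or_ne a 0 with ha | ha
  · subst ha; rw [zero_pow two_ne_zero] at h; exact (pow_eq_zero_iff two_ne_zero).1 h.symm ▸ rfl
  rcases eq_or_ne b 0 with hb | hb
  · subst hb; rw [zero_pow two_ne_zero] at h; exact (pow_eq_zero_iff two_ne_zero).1 h
  exact le_antisymm ((pow_le_pow_iff_left₀ zero_le zero_le two_ne_zero).1 h.le) ((pow_le_pow_iff_left₀ zero_le zero_le two_ne_zero).1 h.ge)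

open scoped Classical in
include hw in
/-- **`(−1, π)_v = [res_w (−1)]`** at a TAMELY RAMIFIED non-split place `w ∣ v` of the CM extension (`e(w|v) ≠ 1`, `|2|_w = 1`), for `π` a uniformiser of `L⁺_v`: the tame symbol
`(−1, π)_v = 1 ⟺ −1 ∈ 𝓀_v²` (★ `hilbertSymbol_neg_one_eq_one_iff_of_odd`) and `𝓀_v = 𝓀_w` at a ramified place (★ `isSquare_residue_toPlace_iff_of_ramified`).  This is the `hs₀` the
R-5b END passes when ★ `rankOneUnstable_core_of_signedPairs`'s `s₀` is instantiated with ★ R-4c⁺'s `((hilbertSymbol L⁺_v (−1) π : ℤ) : ℂ)`.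
[cite: Serre1979, Ch. XIV §3] [cite: LabesseLanglands1979, §2 p. 9] -/
theorem intCast_hilbertSymbol_neg_one_eq_ite_of_ramified (he : v.asIdeal.ramificationIdx' w.1.asIdeal ≠ 1) (h2 : Valued.v (2 : w.1.adicCompletion L) = 1)
    {π : v.adicCompletion ↥(maximalRealSubfield L)} (hπ : Valued.v π = WithZero.exp (-1 : ℤ)) :
    ((hilbertSymbol (v.adicCompletion ↥(maximalRealSubfield L)) (-1) π : ℤ) : ℂ) = if IsSquare (residue 𝒪[w.1.adicCompletion L] (-1)) then 1 else -1 := by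
  classical
  have hc1 : IsCMField.complexConj L ≠ 1 := IsCMField.complexConj_ne_one L
  have he2 : v.asIdeal.ramificationIdx' w.1.asIdeal = 2 :=
    Liu2021.LemD1IndexedNonVacuityRamifiedPlace.ramificationIdx'_eq_two_of_ne_one L v (IsCMField.complexConj L) hc1 w hw he
  -- tameness on the base: `|2|_v = 1`
  have h2v : Valued.v (2 : v.adicCompletion ↥(maximalRealSubfield L)) = 1 := by
    have h := h2
    rw [show (2 : (w.1.adicCompletion L)) = toPlace v w 2 from (map_ofNat _ 2).symm, valued_toPlace, he2] at h
    exact eq_of_sq_eq_sq_seam (by rw [h, one_pow])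
  have h2O : IsUnit (2 : Valued.integer (v.adicCompletion ↥(maximalRealSubfield L))) :=
    (Valuation.integer.integers (Valued.v (R := v.adicCompletion ↥(maximalRealSubfield L)))).isUnit_iff_valuation_eq_one.2 h2v
  -- the residue of `−1` across `ι_w`
  have hbr := isSquare_residue_toPlace_iff_of_ramified L (IsCMField.complexConj L) hc1 v w hw he (-1 : Valued.integer (v.adicCompletion ↥(maximalRealSubfield L)))
  have hm1 : (⟨toPlace v w ((-1 : Valued.integer (v.adicCompletion ↥(maximalRealSubfield L))) : v.adicCompletion ↥(maximalRealSubfield L)),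
      toPlace_mem_integer L v w (-1 : Valued.integer (v.adicCompletion ↥(maximalRealSubfield L)))⟩ : 𝒪[w.1.adicCompletion L]) = -1 := by
    apply Subtype.ext
    simp only [Subring.coe_neg, Subring.coe_one, map_neg, map_one]
  rw [hm1] at hbr
  have hres1 : residue (Valued.integer (v.adicCompletion ↥(maximalRealSubfield L))) (-1) = -1 := by rw [map_neg, map_one]
  rw [hres1] at hbr
  -- the tame symbol
  have hiff := hilbertSymbol_neg_one_eq_one_iff_of_odd ↥(maximalRealSubfield L) v h2O (odd_log_valued_of_eq_exp_neg_one L hπ)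
  by_cases hsq : IsSquare (residue 𝒪[w.1.adicCompletion L] (-1))
  · rw [if_pos hsq, hiff.2 (hbr.1 hsq), Int.cast_one]
  · rw [if_neg hsq]
    have hne : hilbertSymbol (v.adicCompletion ↥(maximalRealSubfield L)) (-1) π ≠ 1 := fun h1 => hsq (hbr.2 (hiff.1 h1))
    rcases hilbertSymbol_eq_one_or_eq_neg_one (-1 : v.adicCompletion ↥(maximalRealSubfield L)) π with h | h
    · exact absurd h hne
    · rw [h, Int.cast_neg, Int.cast_one]

end CM

end Literature.NumberTheory.Rogawski1990

end
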